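import Summits.QuantumFields.YangMills.Theorems.BalabanUVNodesN18KingModel
import Literature.MathematicalPhysics.QuantumFieldTheory.King1986.MinimizerBlockDecay

/-!
# Route «BalabanUVNodes» (K3⁵ `SpineGivenEndpointR13SepCoP`, rev 20∕21), DAG node N16 = NE3 — THE KING-MODEL RUNG OF NE3:
# the TWO-RUN MINIMISER DISCREPANCY «run A's minimiser vs run B's minimiser block-averaged back to run A's lattice» has a
# GEOMETRIC RATE with ONE level-free (and volume-free) constant — King 1986 Prop. 3.8 (3.71) line 1 + Thm 3.3, BY NAME

Cell `pub-ymgap`, seat `pub-ymgap-dag-n16-c` (R134 acceleration seat, strategy s1; HUMAN RULING D-0062; chair R424 venue), generation 7.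
`--kind proof --supports stmt-QuantumFields-20296 --as helper` (K3⁵, plan g68 KEY-20; the ⁗ id 20292 is an aside since rev 21).  `bears_on: R4∕N16 · row «R2^ϱ,
the unprinted core»`.

WHY THIS FILE.  Node N16 = NE3 is «the η-rate of Bałaban's constrained minimisers»: the minimal-action configurations of two successive
renormalisation runs (run A at level `k`, run B at level `k+1`, the latter block-averaged once back to run A's lattice) agree, in a gauge,
up to an error decaying geometrically in `k` (statement of record `NE3EnergyWeightedCovShape.NE3EnergyRateWCov`, carriers `N16At`).  Its
«unprinted core R2^ϱ» (director-ym R134 row; census `pub-balaban-gaps/ne/NE3.md` §4 R8: the sup-currency road is WALLED at OSC, R14: the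
abelian∕linear instance has template value only) has a PRINTED AND PROVED scalar model: C. King's block-spin minimisers
`φ_k^ψ = a_kG^η_kQ_k^*ψ` of the `A = 0` U(1)-Higgs scalar field, whose two-spacing comparison is [King1986] Proposition 3.8 (3.71), typed and
proved on Bałaban's tori by seat n18-b (`King1986/MinimizerTwoSpacing.king_prop38_torus`, `…/MinimizerBlockDecay.king_prop38_torus_blocks`)
and majorised to ONE `k`-free constant by seat n18-a (`BalabanUVNodesN18KingModel.prop38Const_le_unif`) — the files the director's R134 row
for this seat names.  Nodes N15 (NE2) and N18 (NE5) carry such KING-MODEL RUNGS (`…N15KingModel*`, `…N18KingModel*`); N16 had none.  THIS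
file is N16's: King compares the two kernels POINTWISE at a fine point `x′` over a coarse point `x`; NE3 compares run A with run B AVERAGED —
so we average King's (3.71) over the `L^{nd}` fine points `x′` over `x` (the `n`-fold block mean `Q_n`), apply it to a datum `ψ` by
linearity, and, on Bałaban's volumes, sum the transported Theorem-3.3 decay over the unit torus with the uniform lattice sums of
`King1986/UniformDecay` — obtaining the SUP-NORM two-run discrepancy `‖φ_k^ψ − Q_nφ_{k+n}^ψ‖_∞ ≤ C·(L^{−γ∕2})^k·‖ψ‖_∞` with `C` depending on
`d, L, a, m², γ` ONLY (not on the level `k`, not on `n`, not on the volume).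

WHAT THIS FILE PROVES (kernel; theorems only — 0 `def`, 0 sorry; the fibre and the block mean are spelled INLINE: the fibre of `x` is
`univ.filter (fun x′ ↦ ∀ μ, x_μ = ⌊x′_μ∕Lⁿ⌋)` and `(Q_nf)(x) = |fibre|⁻¹·Σ_{x′ ∈ fibre} f x′`; nothing of Bałaban's or King's is asserted as a
hypothesis-free fact beyond what the cited tree theorems prove):
* §1 `mem_overFib` ∕ `overFib_nonempty` — the finite set of fine points `x′ ∈ Tor (fine (LⁿLᵏ) M)` OVER `x ∈ Tor (fine Lᵏ M)` (King p. 664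
  «x′ ∈ Bⁿ(x)», typed as n18-b types it: `x_μ = ⌊x′_μ∕Lⁿ⌋`) is non-empty (the corner `Lⁿ·x` lies over `x`); the AVERAGING INEQUALITY
  `abs_blockMean_sub_le` for the mean `|s|⁻¹Σ_{x′ ∈ s} f(x′)` over a non-empty finite set and its linearity `blockMean_sum_mul`.
* §2 `datum_eq_sum_single`, `minimiser_apply_eq_sum` — King's minimiser map `ψ ↦ φ^ψ = aN^dA₀⁻¹Qᵀψ` (`King1986.Torus.minimiser`) is LINEAR
  in the datum: `φ^ψ(x) = Σ_b ψ(b)·ℋ(x, b)`, `ℋ(x, b) = φ^{δ_b}(x)`.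
* §3 ★ `twoRun_kernel_blockMean_le` — EVERY VOLUME `M`, odd `L ≥ 2`, `k, n ≥ 1`, `a, m² > 0`, `0 ≤ γ ≤ 1`:
  `|ℋ_k(x, b) − Q_nℋ_{k+n}(·, b)(x)| ≤ C₅(a, L, d, γ)·(L^{−γ})^k` (King's (3.71) line 1 averaged over the fibre; `C₅` = n18-a's uniform constant);
  ★ `twoRun_minimiser_blockMean_le_l1` — the datum form `|φ_k^ψ(x) − (Q_nφ_{k+n}^ψ)(x)| ≤ C₅·(L^{−γ})^k·Σ_b|ψ(b)|`.
* §4 ★★ `twoRun_minimiser_blockMean_le_sup` — on BAŁABAN's VOLUMES (`M_μ = 2Lᵐ`, the tori of the `B1∕B4` tower on which n18-b certified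
  Theorem 3.3's decay): `|φ_K^ψ(x) − (Q_nφ_{K+n}^ψ)(x)| ≤ √(2ac₀C₅)·K_d(δ₀∕2)·(L^{−γ∕2})^K·S` whenever `|ψ| ≤ S` — `δ₀, c₀ > 0` depending on
  `d, L, a, m²` only (`king_prop38_torus_blocks`), `K_d` = `B4Sect5Proof.latticeConst` (`tdistT_sumBound`): UNCONDITIONAL, level-free, volume-free.
* §5 `twoRun_rate_pos` ∕ `twoRun_rate_lt_one` ∕ `twoRun_rate_l1_lt_one` — CONTENT: the rates `L^{−γ∕2}` (§4) and `L^{−γ}` (§3) lie in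
  `]0, 1[` for `γ > 0` (no «θ ≥ 1» triviality).  BINDERS INHABITED: §3 asks only `d ≥ 1`, odd `L ≥ 2`, `k, n ≥ 1`, `a, m² > 0`,
  `0 ≤ γ ≤ 1` and ANY volume `M`; §4 any `B1∕B4`-tower volume `P = (d, L, m, K)`, `K ≥ 1`, with `M_μ := P.sitesPerDir P.K = 2Lᵐ ≠ 0`.

READING FOR ROW N16 (a dictionary, NOT a decl; nothing is inferred across it): run A's minimiser `U_A` (level `k`) ↔ `φ_k^ψ`; run B's
minimiser block-averaged once, `rescale L (bavg L U_B)` ↔ `Q₁φ_{k+1}^ψ` (`n = 1`); NE3's direction `Z` with `U_A^{u} = vary W Z 1` ↔ the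
DIFFERENCE `φ_k^ψ − Q₁φ_{k+1}^ψ` (abelian, no gauge); NE3's geometric rate ↔ King's `(L^{−γ∕2})^k`; the datum `V ∈ dom` ↔ `ψ`.  WHAT THE MODEL
DOES NOT CARRY: the gauge `u`, the covariant (non-linear) block average, the (1.36)∕Landau chart, the η-weighted ENERGY currency and the two
covariant Lipschitz conjuncts of `NE3EnergyRateWCov` — i.e. everything non-abelian; King's constraint is the soft `a_k|Q_kφ − ψ|²`, Bałaban's
the sharp axial one.

HONEST FRAMING.  A MODEL LAYER (template literature, [King1986] is printed AND proved; here re-proved in kernel from the tree's King files BY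
NAME): the mechanism N16 postulates for Bałaban's covariant minimisers holds, with content (`θ < 1`, one constant for all levels and volumes),
for King's `A = 0` scalar minimisers.  NOTHING of [Balaban1985RegularSpaces] ∕ [Balaban1985Variational] is proved or discharged; N16 ∕ NE3 is
NOT discharged (its in-edges N05 — [B8] Thm 4 ∕ Prop 3 at the pinned all-torus members — and N07 — [B11] Thm 1 (8)+(10) — remain hypotheses
of the chain of record); COUNT UNMOVED; count-neutral; one finite torus at a time — NOT ℝ⁴, NOT infinite volume, NOT OS, NOT a mass gap, NOT Clay.

Sources: C. King, *The U(1) Higgs model. I. The continuum limit*, Commun. Math. Phys. **102** (1986) 649–677 [King1986], Prop. 3.8 (3.71)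
p. 664, Thm 3.3 p. 658, §4 pp. 670–674; T. Bałaban, *Regularity and decay of lattice Green's functions*, Commun. Math. Phys. **89** (1983)
571–597 [Balaban1983RegularityDecay], Thm (1.10) p. 573 (the source of King's Thm 3.3, certified on the torus by `B4Thm110ZeroTorus`).
-/

set_option autoImplicit false

noncomputable section

open Real Finset
open scoped BigOperators

namespace Summit.QuantumFields.YangMills.BalabanUVNodes.N16KingModel

open Literature.MathematicalPhysics.QuantumFieldTheory.Balaban1983to89 (Params)
open Literature.MathematicalPhysics.QuantumFieldTheory.Balaban1983to89.B5Prop11Plancherel (Tor fine)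
open Literature.MathematicalPhysics.QuantumFieldTheory.Balaban1983to89.B4Sect5Proof (latticeConst latticeConst_nonneg)
open Literature.MathematicalPhysics.QuantumFieldTheory.King1986
  (aK lemma43Const prop38RateConst prop38PosConst)
open Literature.MathematicalPhysics.QuantumFieldTheory.King1986.Torus
  (minimiser fineOp Qmat blockOf tdistT tdistT_nonneg tdistT_sumBound king_prop38_torus king_prop38_torus_blocks)
open Summit.QuantumFields.YangMills.BalabanUVNodes.N18KingModel
  (prop38Const_le_unif prop38Const_unif_nonneg rpow_neg_natPow kingTheta_pos kingTheta_lt_one kingTheta_le_one kingTheta_eq_sq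
    sqrt_mul_sq_mul)

variable {d : ℕ}

/-! ## §1 The fine points over a coarse point («x′ ∈ Bⁿ(x)», p. 664) and the block mean `Q_n` -/

/-- **THE FIBRE OF FINE POINTS OVER A COARSE POINT** (King p. 664 «When x′ ∈ T_{η′}, we denote by x that point in T_η for which x′ ∈ Bⁿ(x)»,
in n18-b's typing `x_μ = ⌊x′_μ∕Lⁿ⌋`): membership in the finite set of fine points `x′ ∈ Tor (fine (LⁿLᵏ) M)` lying over `x ∈ Tor (fine Lᵏ M)`,
spelled `univ.filter (fun x′ ↦ ∀ μ, x_μ = ⌊x′_μ∕Lⁿ⌋)`, unfolded. [cite: King1986, Prop. 3.8 p.664] -/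
theorem mem_overFib {L k n : ℕ} [NeZero L] {M : Fin d → ℕ} [∀ μ, NeZero (M μ)] {x : Tor (fine (L ^ k) M)}
    {x' : Tor (fine (L ^ n * L ^ k) M)} :
    x' ∈ (Finset.univ.filter fun x' : Tor (fine (L ^ n * L ^ k) M) => ∀ μ, (x μ).val = (x' μ).val / L ^ n)
      ↔ ∀ μ, (x μ).val = (x' μ).val / L ^ n := by
  simp

/-- **The fibre is non-empty**: the corner `x′_μ = Lⁿ·x_μ` of the block `Bⁿ(x)` lies over `x` (`L ≥ 1`). [cite: King1986, Prop. 3.8 p.664] -/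
theorem overFib_nonempty {L : ℕ} [NeZero L] (hL : 1 ≤ L) (k n : ℕ) (M : Fin d → ℕ) [∀ μ, NeZero (M μ)]
    (x : Tor (fine (L ^ k) M)) :
    (Finset.univ.filter fun x' : Tor (fine (L ^ n * L ^ k) M) => ∀ μ, (x μ).val = (x' μ).val / L ^ n).Nonempty := by
  have hLn : 0 < L ^ n := pow_pos (by omega) n
  refine ⟨fun μ => (((x μ).val * L ^ n : ℕ) : ZMod (fine (L ^ n * L ^ k) M μ)), mem_overFib.2 fun μ => ?_⟩
  have hlt : (x μ).val * L ^ n < fine (L ^ n * L ^ k) M μ := by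
    have hx : (x μ).val < L ^ k * M μ := ZMod.val_lt (x μ)
    calc (x μ).val * L ^ n < L ^ k * M μ * L ^ n := Nat.mul_lt_mul_of_pos_right hx hLn
      _ = L ^ n * L ^ k * M μ := by ring
  rw [ZMod.val_natCast, Nat.mod_eq_of_lt hlt, Nat.mul_div_cancel _ hLn]

/-- **THE AVERAGING INEQUALITY** for the mean `|s|⁻¹·Σ_{x′ ∈ s} f(x′)` over a non-empty finite set (with `s` = the fibre over `x` this mean is
the `n`-fold BLOCK MEAN `(Q_nf)(x) = L^{−nd}Σ_{x′ ∈ Bⁿ(x)} f(x′)` of King's (2.4)∕(4.1), run B's field averaged back to run A's lattice): if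
`|f(x′) − t| ≤ C` for every `x′ ∈ s` then the mean is within `C` of `t`. [cite: King1986, (2.4) p.652, (4.1) p.670] -/
theorem abs_blockMean_sub_le {α : Type*} {s : Finset α} (hs : s.Nonempty) {f : α → ℝ} {t C : ℝ}
    (h : ∀ x' ∈ s, |f x' - t| ≤ C) : |((s.card : ℝ))⁻¹ * ∑ x' ∈ s, f x' - t| ≤ C := by
  have hc : (0 : ℝ) < s.card := by exact_mod_cast hs.card_pos
  have hC : 0 ≤ C := by obtain ⟨x', hx'⟩ := hs; exact (abs_nonneg _).trans (h x' hx')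
  have hrew : ((s.card : ℝ))⁻¹ * ∑ x' ∈ s, f x' - t = ((s.card : ℝ))⁻¹ * ∑ x' ∈ s, (f x' - t) := by
    rw [Finset.sum_sub_distrib, Finset.sum_const, nsmul_eq_mul, mul_sub, ← mul_assoc, inv_mul_cancel₀ hc.ne', one_mul]
  rw [hrew, abs_mul, abs_of_pos (inv_pos.2 hc)]
  calc ((s.card : ℝ))⁻¹ * |∑ x' ∈ s, (f x' - t)| ≤ ((s.card : ℝ))⁻¹ * ∑ x' ∈ s, |f x' - t| :=
        mul_le_mul_of_nonneg_left (Finset.abs_sum_le_sum_abs _ _) (inv_pos.2 hc).le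
    _ ≤ ((s.card : ℝ))⁻¹ * ∑ _x' ∈ s, C := mul_le_mul_of_nonneg_left (Finset.sum_le_sum h) (inv_pos.2 hc).le
    _ = C := by rw [Finset.sum_const, nsmul_eq_mul, ← mul_assoc, inv_mul_cancel₀ hc.ne', one_mul]

/-- The mean is linear: the mean of `x′ ↦ Σ_b ψ(b)·g_b(x′)` is `Σ_b ψ(b)·(mean of g_b)`. [folklore] -/
theorem blockMean_sum_mul {α β : Type*} [Fintype β] (s : Finset α) (ψ : β → ℝ) (g : β → α → ℝ) :
    ((s.card : ℝ))⁻¹ * ∑ x' ∈ s, (∑ b, ψ b * g b x') = ∑ b, ψ b * (((s.card : ℝ))⁻¹ * ∑ x' ∈ s, g b x') := by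
  rw [Finset.sum_comm, Finset.mul_sum]
  refine Finset.sum_congr rfl fun b _ => ?_
  rw [← Finset.mul_sum]
  ring

/-! ## §2 King's minimiser map is linear in the datum: `φ^ψ(x) = Σ_b ψ(b)·ℋ(x, b)` -/

section Linear

variable (N : ℕ) [NeZero N] (M : Fin d → ℕ) [∀ μ, NeZero (M μ)]

/-- A datum is the sum of its point masses: `ψ = Σ_b ψ(b)·δ_b`. [folklore] -/
theorem datum_eq_sum_single (ψ : Tor M → ℝ) : ψ = ∑ b, ψ b • (Pi.single b (1 : ℝ) : Tor M → ℝ) := by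
  funext x
  simp only [Finset.sum_apply, Pi.smul_apply, Pi.single_apply, smul_eq_mul, mul_ite, mul_one, mul_zero,
    Finset.sum_ite_eq, Finset.mem_univ, if_true]

/-- **LINEARITY OF KING's MINIMISER MAP IN THE DATUM**: `φ^ψ(x) = Σ_b ψ(b)·ℋ(x, b)` with `ℋ(x, b) = φ^{δ_b}(x)` the minimiser KERNEL of
`King1986/MinimizerFourier` (`minimiser N M a c m² ψ = aN^d·A₀⁻¹Qᵀψ` is a composite of matrix actions). [cite: King1986, (2.13)–(2.15) p.653, (4.2) p.670] -/
theorem minimiser_apply_eq_sum (a c m2 : ℝ) (ψ : Tor M → ℝ) (x : Tor (fine N M)) :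
    minimiser N M a c m2 ψ x = ∑ b, ψ b * minimiser N M a c m2 (Pi.single b 1) x := by
  -- the minimiser map as an `ℝ`-linear map
  let T : (Tor M → ℝ) →ₗ[ℝ] (Tor (fine N M) → ℝ) :=
    (a * (N : ℝ) ^ d) • ((Matrix.mulVecLin ((fineOp N M a c m2)⁻¹)).comp (Matrix.mulVecLin (Qmat N M).transpose))
  have hT : ∀ φ : Tor M → ℝ, minimiser N M a c m2 φ = T φ := fun φ => rfl
  rw [hT, datum_eq_sum_single M ψ, map_sum, Finset.sum_apply]
  refine Finset.sum_congr rfl fun b _ => ?_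
  rw [map_smul, Pi.smul_apply, smul_eq_mul, ← hT, ← datum_eq_sum_single]

end Linear

/-! ## §3 ★ King's (3.71) line 1 AVERAGED OVER THE FIBRE: the two-run discrepancy after block averaging, every volume -/

section EveryVolume

variable {L : ℕ} [NeZero L] (M : Fin d → ℕ) [∀ μ, NeZero (M μ)]

/-- **THE TWO-RUN KERNEL DISCREPANCY AFTER BLOCK AVERAGING** (every volume `M`, odd `L ≥ 2`, `k, n ≥ 1`, `a, m² > 0`, `0 ≤ γ ≤ 1`): with
`ℋ_k(x, b) = (a_kG^η_kQ_k^*δ_b)(x)` on `Tor (fine Lᵏ M)` and `ℋ_{k+n}` on `Tor (fine (LⁿLᵏ) M)` (King's ACTUAL operators, `a_k = aK a L k`,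
`c = η⁻² = (Lᵏ)²`), for every unit site `b` and coarse point `x`,
`|ℋ_k(x, b) − |Bⁿ(x)|⁻¹·Σ_{x′ over x} ℋ_{k+n}(x′, b)| ≤ C₅(a, L, d, γ)·(L^{−γ})^k`, `C₅ = prop38RateConst a a Θ (π²∕4)^d d γ + prop38PosConst a (π²∕4)^d d γ`,
`Θ = 2a((a(1 − L⁻²))⁻¹ + π²∕48 + 1∕3)` — King's Prop. 3.8 (3.71) line 1 at every `x′` of the fibre (`king_prop38_torus`, n18-b) averaged
(`abs_blockMean_sub_le`), the `k, n`-dependence of King's constant majorised by n18-a's `prop38Const_le_unif`, and `(Lᵏ)^{−γ} = (L^{−γ})^k`.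
[cite: King1986, Prop. 3.8 (3.71) p.664, §4 pp.670–674] -/
theorem twoRun_kernel_blockMean_le (hd : 0 < d) (hLodd : Odd L) (hL : 2 ≤ L) {k n : ℕ} (hk : 1 ≤ k) (hn : 1 ≤ n)
    {a m2 : ℝ} (ha : 0 < a) (hm : 0 < m2) {γ : ℝ} (hγ0 : 0 ≤ γ) (hγ1 : γ ≤ 1) (b : Tor M) (x : Tor (fine (L ^ k) M)) :
    |minimiser (L ^ k) M (aK a L k) (((L ^ k : ℕ) : ℝ) ^ 2) m2 (Pi.single b 1) x
        - (((Finset.univ.filter fun x' : Tor (fine (L ^ n * L ^ k) M) => ∀ μ, (x μ).val = (x' μ).val / L ^ n).card : ℝ))⁻¹ *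
          ∑ x' ∈ (Finset.univ.filter fun x' : Tor (fine (L ^ n * L ^ k) M) => ∀ μ, (x μ).val = (x' μ).val / L ^ n),
            minimiser (L ^ n * L ^ k) M (aK a L (k + n)) (((L ^ n * L ^ k : ℕ) : ℝ) ^ 2) m2 (Pi.single b 1) x'|
      ≤ (prop38RateConst a a (a * (2 * ((a * (1 - ((L : ℝ) ^ 2)⁻¹))⁻¹ + π ^ 2 / 48 + 1 / 3))) ((π ^ 2 / 4) ^ d) d γ
          + prop38PosConst a ((π ^ 2 / 4) ^ d) d γ) * ((L : ℝ) ^ (-γ)) ^ k := by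
  rw [abs_sub_comm]
  refine abs_blockMean_sub_le (overFib_nonempty (by omega) k n M x) fun x' hx' => ?_
  have h := king_prop38_torus hd hLodd hL hk hn M ha hm hγ0 hγ1 b x x' (mem_overFib.1 hx')
  refine h.trans ?_
  rw [rpow_neg_natPow]
  exact mul_le_mul_of_nonneg_right (prop38Const_le_unif hd ha hL hk hn (by linarith))
    (pow_nonneg (kingTheta_pos (by omega) γ).le k)

/-- ★ **THE TWO-RUN MINIMISER DISCREPANCY AFTER BLOCK AVERAGING — DATUM FORM, EVERY VOLUME**: for every datum `ψ` on the unit torus and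
every coarse point `x`, with `φ_k^ψ = minimiser Lᵏ M a_k (Lᵏ)² m² ψ` (run A) and `φ_{k+n}^ψ` (run B) and the `n`-fold block mean `Q_n` over
the fibre of `x`: `|φ_k^ψ(x) − (Q_nφ_{k+n}^ψ)(x)| ≤ C₅(a, L, d, γ)·(L^{−γ})^k·Σ_b|ψ(b)|` — linearity in the datum (`minimiser_apply_eq_sum`,
`blockMean_sum_mul`) over the kernel bound `twoRun_kernel_blockMean_le`.  NE3's local half IN KING's MODEL, `ℓ¹`-datum form.
[cite: King1986, Prop. 3.8 (3.71) p.664, (2.13)–(2.15) p.653] -/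
theorem twoRun_minimiser_blockMean_le_l1 (hd : 0 < d) (hLodd : Odd L) (hL : 2 ≤ L) {k n : ℕ} (hk : 1 ≤ k) (hn : 1 ≤ n)
    {a m2 : ℝ} (ha : 0 < a) (hm : 0 < m2) {γ : ℝ} (hγ0 : 0 ≤ γ) (hγ1 : γ ≤ 1) (ψ : Tor M → ℝ) (x : Tor (fine (L ^ k) M)) :
    |minimiser (L ^ k) M (aK a L k) (((L ^ k : ℕ) : ℝ) ^ 2) m2 ψ x
        - (((Finset.univ.filter fun x' : Tor (fine (L ^ n * L ^ k) M) => ∀ μ, (x μ).val = (x' μ).val / L ^ n).card : ℝ))⁻¹ *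
          ∑ x' ∈ (Finset.univ.filter fun x' : Tor (fine (L ^ n * L ^ k) M) => ∀ μ, (x μ).val = (x' μ).val / L ^ n),
            minimiser (L ^ n * L ^ k) M (aK a L (k + n)) (((L ^ n * L ^ k : ℕ) : ℝ) ^ 2) m2 ψ x'|
      ≤ (prop38RateConst a a (a * (2 * ((a * (1 - ((L : ℝ) ^ 2)⁻¹))⁻¹ + π ^ 2 / 48 + 1 / 3))) ((π ^ 2 / 4) ^ d) d γ
          + prop38PosConst a ((π ^ 2 / 4) ^ d) d γ) * ((L : ℝ) ^ (-γ)) ^ k * ∑ b, |ψ b| := by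
  set F := (Finset.univ.filter fun x' : Tor (fine (L ^ n * L ^ k) M) => ∀ μ, (x μ).val = (x' μ).val / L ^ n) with hF
  set C : ℝ := (prop38RateConst a a (a * (2 * ((a * (1 - ((L : ℝ) ^ 2)⁻¹))⁻¹ + π ^ 2 / 48 + 1 / 3))) ((π ^ 2 / 4) ^ d) d γ
    + prop38PosConst a ((π ^ 2 / 4) ^ d) d γ) * ((L : ℝ) ^ (-γ)) ^ k with hC
  -- expand both runs in the datum
  have hA := minimiser_apply_eq_sum (L ^ k) M (aK a L k) (((L ^ k : ℕ) : ℝ) ^ 2) m2 ψ x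
  have hB : ((F.card : ℝ))⁻¹ * ∑ x' ∈ F, minimiser (L ^ n * L ^ k) M (aK a L (k + n)) (((L ^ n * L ^ k : ℕ) : ℝ) ^ 2) m2 ψ x'
      = ∑ b, ψ b * (((F.card : ℝ))⁻¹ * ∑ x' ∈ F,
          minimiser (L ^ n * L ^ k) M (aK a L (k + n)) (((L ^ n * L ^ k : ℕ) : ℝ) ^ 2) m2 (Pi.single b 1) x') := by
    rw [← blockMean_sum_mul]
    refine congrArg _ (Finset.sum_congr rfl fun x' _ => ?_)
    exact minimiser_apply_eq_sum (L ^ n * L ^ k) M (aK a L (k + n)) (((L ^ n * L ^ k : ℕ) : ℝ) ^ 2) m2 ψ x'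
  rw [hA, hB, ← Finset.sum_sub_distrib]
  calc |∑ b, (ψ b * minimiser (L ^ k) M (aK a L k) (((L ^ k : ℕ) : ℝ) ^ 2) m2 (Pi.single b 1) x
          - ψ b * (((F.card : ℝ))⁻¹ * ∑ x' ∈ F,
              minimiser (L ^ n * L ^ k) M (aK a L (k + n)) (((L ^ n * L ^ k : ℕ) : ℝ) ^ 2) m2 (Pi.single b 1) x'))|
      ≤ ∑ b, |ψ b * minimiser (L ^ k) M (aK a L k) (((L ^ k : ℕ) : ℝ) ^ 2) m2 (Pi.single b 1) x
          - ψ b * (((F.card : ℝ))⁻¹ * ∑ x' ∈ F,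
              minimiser (L ^ n * L ^ k) M (aK a L (k + n)) (((L ^ n * L ^ k : ℕ) : ℝ) ^ 2) m2 (Pi.single b 1) x')| :=
        Finset.abs_sum_le_sum_abs _ _
    _ ≤ ∑ b, |ψ b| * C := by
        refine Finset.sum_le_sum fun b _ => ?_
        rw [← mul_sub, abs_mul]
        exact mul_le_mul_of_nonneg_left (twoRun_kernel_blockMean_le M hd hLodd hL hk hn ha hm hγ0 hγ1 b x) (abs_nonneg _)
    _ = C * ∑ b, |ψ b| := by rw [← Finset.sum_mul, mul_comm]

end EveryVolume

/-! ## §4 ★★ On Bałaban's volumes: the SUP-NORM two-run discrepancy with King's decay — level-free AND volume-free constant -/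

/-- ★★ **NE3's LOCAL HALF IN KING's MODEL, SUP-NORM FORM, UNCONDITIONAL** (King's Prop. 3.8 (3.71) line 1 «combined with Theorem 3.3», averaged
and summed).  For `d ≥ 1`, odd `L ≥ 2`, `a, m² > 0`, `0 ≤ γ ≤ 1` there are `δ₀, c₀ > 0` (functions of `d, L, a, m²` only — n18-b's
`king_prop38_torus_blocks`) such that for EVERY volume `P = (d, L, m, K)` of the `B1∕B4` tower with `K ≥ 1` (unit torus `M_μ = 2Lᵐ`), every
`n ≥ 1`, every datum `ψ` with `|ψ| ≤ S` and every coarse point `x`: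
`|φ_K^ψ(x) − (Q_nφ_{K+n}^ψ)(x)| ≤ √(2ac₀·C₅(a, L, d, γ)) · K_d(δ₀∕2) · (L^{−γ∕2})^K · S`,
`K_d = B4Sect5Proof.latticeConst d` (the uniform lattice sum `Σ_b e^{−(δ₀∕2)·|B(x) − b|} ≤ K_d(δ₀∕2)`, `King1986/UniformDecay.tdistT_sumBound`).
The constant reads NEITHER the level `K` NOR `n` NOR the volume: the scalar template of N16's geometric two-run rate.
[cite: King1986, Prop. 3.8 (3.71) p.664, Thm 3.3 p.658, p.674; Balaban1983RegularityDecay, Thm (1.10) p.573] -/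
theorem twoRun_minimiser_blockMean_le_sup (dd L : ℕ) (hd : 1 ≤ dd) (hLodd : Odd L) (hL : 2 ≤ L) {a m2 : ℝ} (ha : 0 < a)
    (hm : 0 < m2) {γ : ℝ} (hγ0 : 0 ≤ γ) (hγ1 : γ ≤ 1) :
    ∃ δ₀ c₀ : ℝ, 0 < δ₀ ∧ 0 < c₀ ∧ ∀ (P : Params) (_hPd : P.d = dd) (_hPL : P.L = L) (_hK : 1 ≤ P.K) [NeZero P.L]
      (n : ℕ) (_hn : 1 ≤ n) (M : Fin P.d → ℕ) [∀ μ, NeZero (M μ)] (_hMK : ∀ μ, M μ = P.sitesPerDir P.K)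
      (ψ : Tor M → ℝ) (S : ℝ) (_hS : ∀ b, |ψ b| ≤ S) (xt : Tor (fine (P.L ^ P.K) M)),
      |minimiser (P.L ^ P.K) M (aK a P.L P.K) (((P.L ^ P.K : ℕ) : ℝ) ^ 2) m2 ψ xt
          - (((Finset.univ.filter fun x' : Tor (fine (P.L ^ n * P.L ^ P.K) M) => ∀ μ, (xt μ).val = (x' μ).val / P.L ^ n).card : ℝ))⁻¹ *
            ∑ x' ∈ (Finset.univ.filter fun x' : Tor (fine (P.L ^ n * P.L ^ P.K) M) => ∀ μ, (xt μ).val = (x' μ).val / P.L ^ n),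
              minimiser (P.L ^ n * P.L ^ P.K) M (aK a P.L (P.K + n)) (((P.L ^ n * P.L ^ P.K : ℕ) : ℝ) ^ 2) m2 ψ x'|
        ≤ Real.sqrt (2 * (a * c₀) *
              (prop38RateConst a a (a * (2 * ((a * (1 - ((L : ℝ) ^ 2)⁻¹))⁻¹ + π ^ 2 / 48 + 1 / 3))) ((π ^ 2 / 4) ^ dd) dd γ
                + prop38PosConst a ((π ^ 2 / 4) ^ dd) dd γ))
            * latticeConst dd (δ₀ / 2) * ((L : ℝ) ^ (-(γ / 2))) ^ P.K * S := by
  obtain ⟨δ₀, c₀, hδ₀, hc₀, H⟩ := king_prop38_torus_blocks dd L hd hLodd hL ha hm hγ0 hγ1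
  refine ⟨δ₀, c₀, hδ₀, hc₀, ?_⟩
  intro P hPd hPL hK _ n hn M _ hMK ψ S hS xt
  subst hPd hPL
  set F := (Finset.univ.filter fun x' : Tor (fine (P.L ^ n * P.L ^ P.K) M) => ∀ μ, (xt μ).val = (x' μ).val / P.L ^ n) with hF
  have hd0 : 0 < P.d := by omega
  -- names
  set Cu : ℝ := prop38RateConst a a (a * (2 * ((a * (1 - ((P.L : ℝ) ^ 2)⁻¹))⁻¹ + π ^ 2 / 48 + 1 / 3))) ((π ^ 2 / 4) ^ P.d) P.d γ
    + prop38PosConst a ((π ^ 2 / 4) ^ P.d) P.d γ with hCu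
  set Ck : ℝ := prop38RateConst a a (lemma43Const a P.L P.K n) ((π ^ 2 / 4) ^ P.d) P.d γ
    + prop38PosConst a ((π ^ 2 / 4) ^ P.d) P.d γ with hCk
  set s : ℝ := (P.L : ℝ) ^ (-(γ / 2)) with hs_def
  have hs : 0 ≤ s := Real.rpow_nonneg (Nat.cast_nonneg _) _
  have hCle : Ck ≤ Cu := prop38Const_le_unif hd0 ha hL hK hn (by linarith)
  have hS0 : 0 ≤ S := (abs_nonneg _).trans (hS 0)
  -- the per-kernel bound at every fine point over `xt`, with King's decay, rate rewritten as `(L^{−γ/2})^K` and constant majorised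
  have hker : ∀ bt : Tor M,
      |minimiser (P.L ^ P.K) M (aK a P.L P.K) (((P.L ^ P.K : ℕ) : ℝ) ^ 2) m2 (Pi.single bt 1) xt
          - ((F.card : ℝ))⁻¹ * ∑ x' ∈ F, minimiser (P.L ^ n * P.L ^ P.K) M (aK a P.L (P.K + n))
              (((P.L ^ n * P.L ^ P.K : ℕ) : ℝ) ^ 2) m2 (Pi.single bt 1) x'|
        ≤ Real.sqrt (2 * (a * c₀) * Cu) * s ^ P.K * Real.exp (-(δ₀ / 2 * tdistT M (blockOf (P.L ^ P.K) M xt) bt)) := by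
    intro bt
    rw [abs_sub_comm]
    refine abs_blockMean_sub_le (overFib_nonempty (by omega) P.K n M xt) fun x' hx' => ?_
    have h := H P rfl rfl hK n hn M hMK xt x' bt (mem_overFib.1 hx')
    refine h.trans ?_
    have hrate : ((P.L ^ P.K : ℕ) : ℝ) ^ (-γ) = (s ^ P.K) ^ 2 := by
      rw [rpow_neg_natPow, kingTheta_eq_sq, ← pow_mul, ← pow_mul, mul_comm]
    have hsq : Real.sqrt (Ck * ((P.L ^ P.K : ℕ) : ℝ) ^ (-γ) * (2 * (a * c₀))) = Real.sqrt (Ck * (2 * (a * c₀))) * s ^ P.K := by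
      rw [hrate, sqrt_mul_sq_mul (pow_nonneg hs _)]
    have hmono : Real.sqrt (Ck * (2 * (a * c₀))) ≤ Real.sqrt (2 * (a * c₀) * Cu) := by
      rw [mul_comm Ck]
      exact Real.sqrt_le_sqrt (mul_le_mul_of_nonneg_left hCle (by positivity))
    rw [hsq]
    gcongr
  -- expand both runs in the datum and sum the decay over the unit torus
  have hA := minimiser_apply_eq_sum (P.L ^ P.K) M (aK a P.L P.K) (((P.L ^ P.K : ℕ) : ℝ) ^ 2) m2 ψ xt
  have hB : ((F.card : ℝ))⁻¹ * ∑ x' ∈ F, minimiser (P.L ^ n * P.L ^ P.K) M (aK a P.L (P.K + n))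
        (((P.L ^ n * P.L ^ P.K : ℕ) : ℝ) ^ 2) m2 ψ x'
      = ∑ b, ψ b * (((F.card : ℝ))⁻¹ * ∑ x' ∈ F, minimiser (P.L ^ n * P.L ^ P.K) M (aK a P.L (P.K + n))
          (((P.L ^ n * P.L ^ P.K : ℕ) : ℝ) ^ 2) m2 (Pi.single b 1) x') := by
    rw [← blockMean_sum_mul]
    refine congrArg _ (Finset.sum_congr rfl fun x' _ => ?_)
    exact minimiser_apply_eq_sum (P.L ^ n * P.L ^ P.K) M (aK a P.L (P.K + n)) (((P.L ^ n * P.L ^ P.K : ℕ) : ℝ) ^ 2) m2 ψ x'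
  have hsum : ∑ b : Tor M, Real.exp (-(δ₀ / 2 * tdistT M (blockOf (P.L ^ P.K) M xt) b)) ≤ latticeConst P.d (δ₀ / 2) :=
    tdistT_sumBound M (δ₀ / 2) (by positivity) (blockOf (P.L ^ P.K) M xt)
  have hR0 : 0 ≤ Real.sqrt (2 * (a * c₀) * Cu) * s ^ P.K := mul_nonneg (Real.sqrt_nonneg _) (pow_nonneg hs _)
  rw [hA, hB, ← Finset.sum_sub_distrib]
  calc |∑ b, (ψ b * minimiser (P.L ^ P.K) M (aK a P.L P.K) (((P.L ^ P.K : ℕ) : ℝ) ^ 2) m2 (Pi.single b 1) xt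
          - ψ b * (((F.card : ℝ))⁻¹ * ∑ x' ∈ F, minimiser (P.L ^ n * P.L ^ P.K) M (aK a P.L (P.K + n))
              (((P.L ^ n * P.L ^ P.K : ℕ) : ℝ) ^ 2) m2 (Pi.single b 1) x'))|
      ≤ ∑ b, |ψ b * minimiser (P.L ^ P.K) M (aK a P.L P.K) (((P.L ^ P.K : ℕ) : ℝ) ^ 2) m2 (Pi.single b 1) xt
          - ψ b * (((F.card : ℝ))⁻¹ * ∑ x' ∈ F, minimiser (P.L ^ n * P.L ^ P.K) M (aK a P.L (P.K + n))
              (((P.L ^ n * P.L ^ P.K : ℕ) : ℝ) ^ 2) m2 (Pi.single b 1) x')| := Finset.abs_sum_le_sum_abs _ _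
    _ ≤ ∑ b, S * (Real.sqrt (2 * (a * c₀) * Cu) * s ^ P.K * Real.exp (-(δ₀ / 2 * tdistT M (blockOf (P.L ^ P.K) M xt) b))) := by
        refine Finset.sum_le_sum fun b _ => ?_
        rw [← mul_sub, abs_mul]
        exact mul_le_mul (hS b) (hker b) (abs_nonneg _) hS0
    _ = Real.sqrt (2 * (a * c₀) * Cu) * s ^ P.K * S * ∑ b, Real.exp (-(δ₀ / 2 * tdistT M (blockOf (P.L ^ P.K) M xt) b)) := by
        rw [← Finset.mul_sum, ← Finset.mul_sum]; ring
    _ ≤ Real.sqrt (2 * (a * c₀) * Cu) * s ^ P.K * S * latticeConst P.d (δ₀ / 2) :=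
        mul_le_mul_of_nonneg_left hsum (mul_nonneg hR0 hS0)
    _ = Real.sqrt (2 * (a * c₀) * Cu) * latticeConst P.d (δ₀ / 2) * s ^ P.K * S := by ring

/-! ## §5 CONTENT: the rate lies in `]0, 1[` for `γ > 0` -/

/-- The two-run rate `L^{−γ∕2}` is positive (`L ≥ 1`). [cite: King1986, Prop. 3.8 (3.71) p.664] -/
theorem twoRun_rate_pos {L : ℕ} (hL : 1 ≤ L) (γ : ℝ) : 0 < (L : ℝ) ^ (-(γ / 2)) := kingTheta_pos hL (γ / 2)

/-- **CONTENT (no «θ ≥ 1» triviality)**: for `L ≥ 2` and `γ > 0` the two-run rate `L^{−γ∕2}` is `< 1`, so §4's bound DECAYS GEOMETRICALLY in the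
level `K` — the feature N16 ∕ NE3 postulates for Bałaban's covariant minimisers, here a theorem for King's scalar ones. [cite: King1986, Prop. 3.8 (3.71) p.664, p.665] -/
theorem twoRun_rate_lt_one {L : ℕ} (hL : 2 ≤ L) {γ : ℝ} (hγ : 0 < γ) : (L : ℝ) ^ (-(γ / 2)) < 1 :=
  kingTheta_lt_one hL (by linarith)

/-- The every-volume rate `L^{−γ}` of §3 is `≤ 1` (`γ ≥ 0`) and `< 1` for `γ > 0`. [cite: King1986, Prop. 3.8 (3.71) p.664] -/
theorem twoRun_rate_l1_lt_one {L : ℕ} (hL : 2 ≤ L) {γ : ℝ} (hγ : 0 < γ) : 0 < (L : ℝ) ^ (-γ) ∧ (L : ℝ) ^ (-γ) < 1 :=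
  ⟨kingTheta_pos (by omega) γ, kingTheta_lt_one hL hγ⟩

end Summit.QuantumFields.YangMills.BalabanUVNodes.N16KingModel

end
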